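import Literature.Geometry.DiscreteGeometry.SphericalPolygonArea
import HarnessLib

/-!
# Distance from a point to a spherical segment, the cross product, and the sixty-degree point
# of an arc — vector bricks for (d3) «one rattler per p-hexagon»

HONEST FRAMING. Part of the venture `Summits/Ventures/Crystal3D` (cell `pub-crystal3d`, phase 2;
seat typer-bulk-2), generic and configuration-free: vectors of `ℝ³`, the orientation `orient3`
(`Literature…SphericalPolygonPerimeter.lean`) and inner products. Nothing here mentions
GAP(1.26). The census row (d3) of `DESIGN-L12-THEORY.md` §P-L3 («a p-hexagon hosts at most one
rattler»; paper proof `phase2/theory1/HEX-PERIMETER.md`, plan `HOME/lean/hexper/README.md`) is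
a perimeter argument about two `r₀`-caps inside a convex hexagon. This file supplies:

* `cross3 u v` — the cross product as a vector of `EuclideanSpace ℝ (Fin 3)`,
  `⟪cross3 u v, x⟫ = orient3 u v x`, Lagrange's identity for its norm;
* **per-edge bound** `inner_combo_le_sqrt_mul_norm` — if `⟪z,v⟫ ≤ κ₁`, `⟪z,w⟫ ≤ κ₂`,
  `⟪v,w⟫ = c` and the `2 × 2` form `M(a²+b²+2abc) − (aκ₁+bκ₂)²` is positive semidefinite, then
  `⟪z, a v + b w⟫ ≤ √M ‖a v + b w‖` for all `a, b ≥ 0`: the point `z` is at spherical distance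
  `≥ arccos √M` from the whole segment `vw`; instances `…_of_shell_edge` (`κ₁ = κ₂ = c = 1/2`)
  and `…_of_hole_edge` (`κ₁ = c = κ ∈ [0, 63/100]`, `κ₂ = 1/2`) with the uniform constant
  `M = 83/200` (`r₀ = arccos √(83/200) ≈ 49.89°`) — the rattler rows of the census hexagon: four
  `60°`-sides and the two `ρ`-sides at the hole, `κ = D/2 ≤ 0.63` on the census window;
* **sixty-degree point** `sixtyPoint z₁ z₂` — for unit `z₁, z₂` with `−1 < ⟪z₁,z₂⟫ ≤ 1/2`, the
  unit point of the arc `z₁z₂` with `⟪z₁, sixtyPoint z₁ z₂⟫ = 1/2`; it is a nonnegative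
  combination of `z₁, z₂` with coefficient sum `≥ 1`, so lower bounds `t ≤ ⟪N, z₁⟫, ⟪N, z₂⟫`
  (`t ≥ 0`) transfer to it (`le_inner_sixtyPoint`) — two rattlers `≥ 60°` apart are replaced by
  two points EXACTLY `60°` apart, which turns every constant of the perimeter argument into a
  number.
-/

noncomputable section

namespace Summit.Ventures.Crystal3D

open Literature.Geometry.DiscreteGeometry Real InnerProductGeometry Finset
open scoped InnerProductSpace RealInnerProductSpace

local notation "E3" => EuclideanSpace ℝ (Fin 3)

/-! ## Part A. The cross product as a vector -/

/-- The cross product of two vectors of `ℝ³` as a vector of `EuclideanSpace ℝ (Fin 3)` (the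
Riesz representative of the functional `orient3 u v ·`). -/
def cross3 (u v : E3) : E3 :=
  (WithLp.equiv 2 (Fin 3 → ℝ)).symm
    ![u 1 * v 2 - u 2 * v 1, u 2 * v 0 - u 0 * v 2, u 0 * v 1 - u 1 * v 0]

/-- First coordinate of the cross product. -/
@[simp] theorem cross3_apply_zero (u v : E3) : cross3 u v 0 = u 1 * v 2 - u 2 * v 1 := rfl

/-- Second coordinate of the cross product. -/
@[simp] theorem cross3_apply_one (u v : E3) : cross3 u v 1 = u 2 * v 0 - u 0 * v 2 := rfl

/-- Third coordinate of the cross product. -/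
@[simp] theorem cross3_apply_two (u v : E3) : cross3 u v 2 = u 0 * v 1 - u 1 * v 0 := rfl

/-- `⟪cross3 u v, x⟫ = orient3 u v x`. -/
theorem inner_cross3_left (u v x : E3) : ⟪cross3 u v, x⟫ = orient3 u v x := by
  simp only [orient3, PiLp.inner_apply, RCLike.inner_apply, conj_trivial, Fin.sum_univ_three,
    cross3_apply_zero, cross3_apply_one, cross3_apply_two]
  ring

/-- `⟪x, cross3 u v⟫ = orient3 u v x`. -/
theorem inner_cross3_right (u v x : E3) : ⟪x, cross3 u v⟫ = orient3 u v x := by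
  rw [real_inner_comm, inner_cross3_left]

/-- **Lagrange's identity**: `‖u × v‖² = ‖u‖² ‖v‖² − ⟪u,v⟫²`. -/
theorem norm_cross3_sq (u v : E3) : ‖cross3 u v‖ ^ 2 = ‖u‖ ^ 2 * ‖v‖ ^ 2 - ⟪u, v⟫ ^ 2 := by
  have hu : ‖u‖ ^ 2 = u 0 * u 0 + u 1 * u 1 + u 2 * u 2 := by
    rw [← real_inner_self_eq_norm_sq]
    simp only [PiLp.inner_apply, RCLike.inner_apply, conj_trivial, Fin.sum_univ_three]
  have hv : ‖v‖ ^ 2 = v 0 * v 0 + v 1 * v 1 + v 2 * v 2 := by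
    rw [← real_inner_self_eq_norm_sq]
    simp only [PiLp.inner_apply, RCLike.inner_apply, conj_trivial, Fin.sum_univ_three]
  have hc : ‖cross3 u v‖ ^ 2 = cross3 u v 0 * cross3 u v 0 + cross3 u v 1 * cross3 u v 1 +
      cross3 u v 2 * cross3 u v 2 := by
    rw [← real_inner_self_eq_norm_sq]
    simp only [PiLp.inner_apply, RCLike.inner_apply, conj_trivial, Fin.sum_univ_three]
  have huv : ⟪u, v⟫ = v 0 * u 0 + v 1 * u 1 + v 2 * u 2 := by
    simp only [PiLp.inner_apply, RCLike.inner_apply, conj_trivial, Fin.sum_univ_three]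
  rw [hc, hu, hv, huv]
  simp only [cross3_apply_zero, cross3_apply_one, cross3_apply_two]
  ring

/-- The cross product is orthogonal to its first factor. -/
@[simp] theorem inner_cross3_self_left (u v : E3) : ⟪cross3 u v, u⟫ = 0 := by
  rw [inner_cross3_left, orient3_self_outer]

/-- The cross product is orthogonal to its second factor. -/
@[simp] theorem inner_cross3_self_right (u v : E3) : ⟪cross3 u v, v⟫ = 0 := by
  rw [inner_cross3_left, orient3_self_right]

/-- If `orient3 u v x ≠ 0` then `cross3 u v ≠ 0`. -/
theorem cross3_ne_zero_of_orient3_ne_zero {u v x : E3} (h : orient3 u v x ≠ 0) : cross3 u v ≠ 0 := by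
  intro h0
  apply h
  rw [← inner_cross3_left, h0, inner_zero_left]

/-! ## Part B. The per-edge quadratic-form bound (distance from a point to a segment) -/

/-- A positive semidefinite binary quadratic form is nonnegative on all of `ℝ²`. -/
theorem binary_form_nonneg {A B C : ℝ} (hA : 0 ≤ A) (hB : 0 ≤ B) (hdet : C ^ 2 ≤ A * B)
    (a b : ℝ) : 0 ≤ A * a ^ 2 + 2 * C * (a * b) + B * b ^ 2 := by
  rcases hA.lt_or_eq with hA' | hA'
  · have h1 : A * a ^ 2 + 2 * C * (a * b) + B * b ^ 2 =
        ((A * a + C * b) ^ 2 + (A * B - C ^ 2) * b ^ 2) / A := by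
      field_simp
      ring
    rw [h1]
    apply div_nonneg _ hA
    nlinarith [sq_nonneg (A * a + C * b), sq_nonneg b]
  · subst hA'
    have hC : C = 0 := by nlinarith [sq_nonneg C]
    subst hC
    nlinarith [sq_nonneg b]

/-- **Per-edge bound.** If `⟪z,v⟫ ≤ κ₁`, `⟪z,w⟫ ≤ κ₂` (with `‖v‖ = ‖w‖ = 1`, `⟪v,w⟫ = c`) and
the form `M(a² + b² + 2abc) − (aκ₁ + bκ₂)²` is positive semidefinite (`κ₁² ≤ M`, `κ₂² ≤ M`,
`(Mc − κ₁κ₂)² ≤ (M − κ₁²)(M − κ₂²)`), then `⟪z, a v + b w⟫ ≤ √M · ‖a v + b w‖` for all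
`a, b ≥ 0`: the point `z` is at spherical distance `≥ arccos √M` from the segment `vw`. -/
theorem inner_combo_le_sqrt_mul_norm {z v w : E3} (hv : ‖v‖ = 1) (hw : ‖w‖ = 1) {κ₁ κ₂ c M : ℝ}
    (hzv : ⟪z, v⟫ ≤ κ₁) (hzw : ⟪z, w⟫ ≤ κ₂) (hvw : ⟪v, w⟫ = c) (hM : 0 ≤ M) (h1 : κ₁ ^ 2 ≤ M)
    (h2 : κ₂ ^ 2 ≤ M) (hdet : (M * c - κ₁ * κ₂) ^ 2 ≤ (M - κ₁ ^ 2) * (M - κ₂ ^ 2))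
    {a b : ℝ} (ha : 0 ≤ a) (hb : 0 ≤ b) :
    ⟪z, a • v + b • w⟫ ≤ Real.sqrt M * ‖a • v + b • w‖ := by
  have hlin : ⟪z, a • v + b • w⟫ ≤ a * κ₁ + b * κ₂ := by
    rw [inner_add_right, real_inner_smul_right, real_inner_smul_right]
    nlinarith [mul_le_mul_of_nonneg_left hzv ha, mul_le_mul_of_nonneg_left hzw hb]
  have hns : ‖a • v + b • w‖ ^ 2 = a ^ 2 + b ^ 2 + 2 * a * b * c := by
    have hwv : ⟪w, v⟫ = c := by rw [real_inner_comm]; exact hvw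
    have hvv : ⟪v, v⟫ = 1 := by rw [real_inner_self_eq_norm_sq, hv, one_pow]
    have hww : ⟪w, w⟫ = 1 := by rw [real_inner_self_eq_norm_sq, hw, one_pow]
    rw [← real_inner_self_eq_norm_sq]
    simp only [inner_add_left, inner_add_right, real_inner_smul_left, real_inner_smul_right, hvv,
      hww, hvw, hwv]
    ring
  have hform : (a * κ₁ + b * κ₂) ^ 2 ≤ M * ‖a • v + b • w‖ ^ 2 := by
    rw [hns]
    have := binary_form_nonneg (sub_nonneg.2 h1) (sub_nonneg.2 h2) hdet a b
    nlinarith [this]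
  rcases le_or_gt (a * κ₁ + b * κ₂) 0 with hL | hL
  · exact hlin.trans (hL.trans (mul_nonneg (Real.sqrt_nonneg _) (norm_nonneg _)))
  · have hR : 0 ≤ Real.sqrt M * ‖a • v + b • w‖ := mul_nonneg (Real.sqrt_nonneg _) (norm_nonneg _)
    have hsq : (a * κ₁ + b * κ₂) ^ 2 ≤ (Real.sqrt M * ‖a • v + b • w‖) ^ 2 := by
      rw [mul_pow, Real.sq_sqrt hM]; exact hform
    have hle : a * κ₁ + b * κ₂ ≤ Real.sqrt M * ‖a • v + b • w‖ := by
      have h := Real.sqrt_le_sqrt hsq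
      rwa [Real.sqrt_sq hL.le, Real.sqrt_sq hR] at h
    exact hlin.trans hle

/-- **Shell edge** (`60°` side of the hexagon, rattler rows at both ends): `⟪z,v⟫ ≤ 1/2`,
`⟪z,w⟫ ≤ 1/2`, `⟪v,w⟫ = 1/2` give `⟪z, a v + b w⟫ ≤ √(83/200) ‖a v + b w‖` for `a, b ≥ 0`
(the sharp constant would be `1/3`; `83/200` is the uniform constant of the hexagon). -/
theorem inner_combo_le_of_shell_edge {z v w : E3} (hv : ‖v‖ = 1) (hw : ‖w‖ = 1)
    (hzv : ⟪z, v⟫ ≤ 1 / 2) (hzw : ⟪z, w⟫ ≤ 1 / 2) (hvw : ⟪v, w⟫ = 1 / 2) {a b : ℝ} (ha : 0 ≤ a)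
    (hb : 0 ≤ b) : ⟪z, a • v + b • w⟫ ≤ Real.sqrt (83 / 200) * ‖a • v + b • w‖ :=
  inner_combo_le_sqrt_mul_norm hv hw hzv hzw hvw (by norm_num) (by norm_num) (by norm_num)
    (by norm_num) ha hb

/-- **Hole edge** (a `ρ`-side `p v` of the hexagon, `⟪p,v⟫ = κ = D/2`, rattler rows
`⟪z,p⟫ ≤ κ`, `⟪z,v⟫ ≤ 1/2`): for `0 ≤ κ ≤ 63/100` (the census window has `κ ∈ [5/8, 63/100]`),
`⟪z, a p + b v⟫ ≤ √(83/200) ‖a p + b v‖` for `a, b ≥ 0`. -/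
theorem inner_combo_le_of_hole_edge {z p v : E3} (hp : ‖p‖ = 1) (hv : ‖v‖ = 1) {κ : ℝ}
    (hκ0 : 0 ≤ κ) (hκ1 : κ ≤ 63 / 100) (hzp : ⟪z, p⟫ ≤ κ) (hzv : ⟪z, v⟫ ≤ 1 / 2)
    (hpv : ⟪p, v⟫ = κ) {a b : ℝ} (ha : 0 ≤ a) (hb : 0 ≤ b) :
    ⟪z, a • p + b • v⟫ ≤ Real.sqrt (83 / 200) * ‖a • p + b • v‖ := by
  refine inner_combo_le_sqrt_mul_norm hp hv hzp hzv hpv (by norm_num) ?_ (by norm_num) ?_ ha hb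
  · nlinarith
  · have hκ2 : κ * κ ≤ 63 / 100 * (63 / 100) := mul_le_mul hκ1 hκ1 hκ0 (by norm_num)
    nlinarith [hκ2, sq_nonneg κ]

/-! ## Part E. The sixty-degree point of a segment -/

/-- For unit `z₁, z₂` with `c = ⟪z₁, z₂⟫ ∈ (−1, 1/2]`: the point of the great-circle arc from
`z₁` to `z₂` at spherical distance EXACTLY `60°` from `z₁`,
`sixtyPoint z₁ z₂ = (1/2 − c β) z₁ + β z₂` with `β = (√3/2)/√(1 − c²)`. -/
def sixtyPoint (z₁ z₂ : E3) : E3 :=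
  (1 / 2 - ⟪z₁, z₂⟫ * (Real.sqrt 3 / 2 / Real.sqrt (1 - ⟪z₁, z₂⟫ ^ 2))) • z₁ +
    (Real.sqrt 3 / 2 / Real.sqrt (1 - ⟪z₁, z₂⟫ ^ 2)) • z₂

section Sixty

variable {z₁ z₂ : E3} (h₁ : ‖z₁‖ = 1) (h₂ : ‖z₂‖ = 1) (hc1 : -1 < ⟪z₁, z₂⟫) (hc2 : ⟪z₁, z₂⟫ ≤ 1 / 2)
include h₁ h₂ hc1 hc2

omit h₁ h₂ in
/-- The two coefficients of `sixtyPoint` are nonnegative and sum to at least `1`. -/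
theorem sixtyPoint_coeffs :
    0 ≤ 1 / 2 - ⟪z₁, z₂⟫ * (Real.sqrt 3 / 2 / Real.sqrt (1 - ⟪z₁, z₂⟫ ^ 2)) ∧
    0 ≤ Real.sqrt 3 / 2 / Real.sqrt (1 - ⟪z₁, z₂⟫ ^ 2) ∧
    1 ≤ (1 / 2 - ⟪z₁, z₂⟫ * (Real.sqrt 3 / 2 / Real.sqrt (1 - ⟪z₁, z₂⟫ ^ 2))) +
      Real.sqrt 3 / 2 / Real.sqrt (1 - ⟪z₁, z₂⟫ ^ 2) := by
  have hc2' : ⟪z₁, z₂⟫ ^ 2 < 1 := by nlinarith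
  have hS : 0 < Real.sqrt (1 - ⟪z₁, z₂⟫ ^ 2) := Real.sqrt_pos.2 (by linarith)
  have hS2 : Real.sqrt (1 - ⟪z₁, z₂⟫ ^ 2) ^ 2 = 1 - ⟪z₁, z₂⟫ ^ 2 := Real.sq_sqrt (by linarith)
  have h3 : Real.sqrt 3 ^ 2 = 3 := Real.sq_sqrt (by norm_num)
  have h3p : 0 < Real.sqrt 3 := Real.sqrt_pos.2 (by norm_num)
  set c := ⟪z₁, z₂⟫ with hc
  set S := Real.sqrt (1 - c ^ 2) with hSdef
  have hβ : 0 ≤ Real.sqrt 3 / 2 / S := div_nonneg (div_nonneg h3p.le (by norm_num)) hS.le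
  refine ⟨?_, hβ, ?_⟩
  · -- `c β ≤ 1/2`: trivial for `c ≤ 0`; for `c > 0` square: `3 c² ≤ 1 − c²`
    rcases le_or_gt c 0 with hc0 | hc0
    · nlinarith [mul_nonneg (neg_nonneg.2 hc0) hβ]
    · rw [sub_nonneg, ← mul_div_assoc, div_le_iff₀ hS]
      -- `c √3/2 ≤ S/2`: compare squares of nonnegatives
      have hl : 0 ≤ c * (Real.sqrt 3 / 2) := by positivity
      have hsq : (c * (Real.sqrt 3 / 2)) ^ 2 ≤ (1 / 2 * S) ^ 2 := by
        have e1 : (1 / 2 * S) ^ 2 = (1 - c ^ 2) / 4 := by rw [mul_pow, hS2]; ring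
        have e2 : (c * (Real.sqrt 3 / 2)) ^ 2 = 3 * c ^ 2 / 4 := by rw [mul_pow, div_pow, h3]; ring
        rw [e1, e2]; nlinarith
      have h := Real.sqrt_le_sqrt hsq
      rwa [Real.sqrt_sq hl, Real.sqrt_sq (by positivity)] at h
  · -- `β (1 − c) ≥ 1/2`: square `3 (1 − c)² ≥ (1 − c²) = (1−c)(1+c)`, i.e. `3(1−c) ≥ 1 + c`
    have h1c : 0 < 1 - c := by linarith
    have key : 1 / 2 ≤ Real.sqrt 3 / 2 / S * (1 - c) := by
      rw [div_mul_eq_mul_div, le_div_iff₀ hS]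
      have hl : 0 ≤ 1 / 2 * S := by positivity
      have hsq : (1 / 2 * S) ^ 2 ≤ (Real.sqrt 3 / 2 * (1 - c)) ^ 2 := by
        have e1 : (1 / 2 * S) ^ 2 = (1 - c ^ 2) / 4 := by rw [mul_pow, hS2]; ring
        have e2 : (Real.sqrt 3 / 2 * (1 - c)) ^ 2 = 3 * (1 - c) ^ 2 / 4 := by
          rw [mul_pow, div_pow, h3]; ring
        rw [e1, e2]; nlinarith
      have := Real.sqrt_le_sqrt hsq
      rwa [Real.sqrt_sq hl, Real.sqrt_sq (by positivity)] at this
    nlinarith [key]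

/-- `sixtyPoint` is a unit vector. -/
theorem norm_sixtyPoint : ‖sixtyPoint z₁ z₂‖ = 1 := by
  have hc2' : ⟪z₁, z₂⟫ ^ 2 < 1 := by nlinarith
  have hS : 0 < Real.sqrt (1 - ⟪z₁, z₂⟫ ^ 2) := Real.sqrt_pos.2 (by linarith)
  have hS2 : Real.sqrt (1 - ⟪z₁, z₂⟫ ^ 2) ^ 2 = 1 - ⟪z₁, z₂⟫ ^ 2 := Real.sq_sqrt (by linarith)
  have h3 : Real.sqrt 3 ^ 2 = 3 := Real.sq_sqrt (by norm_num)
  have h11 : ⟪z₁, z₁⟫ = 1 := by rw [real_inner_self_eq_norm_sq, h₁, one_pow]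
  have h22 : ⟪z₂, z₂⟫ = 1 := by rw [real_inner_self_eq_norm_sq, h₂, one_pow]
  have h21 : ⟪z₂, z₁⟫ = ⟪z₁, z₂⟫ := real_inner_comm _ _
  have hsq : ‖sixtyPoint z₁ z₂‖ ^ 2 = 1 := by
    rw [← real_inner_self_eq_norm_sq, sixtyPoint]
    set c := ⟪z₁, z₂⟫
    set β := Real.sqrt 3 / 2 / Real.sqrt (1 - c ^ 2) with hβ
    have hne : 1 - c ^ 2 ≠ 0 := by linarith
    have hβ2 : β ^ 2 * (1 - c ^ 2) = 3 / 4 := by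
      rw [hβ, div_pow, div_pow, h3, hS2]; field_simp; ring
    simp only [inner_add_left, inner_add_right, real_inner_smul_left, real_inner_smul_right, h11, h22,
      h21]
    nlinarith [hβ2]
  have h0 : 0 ≤ ‖sixtyPoint z₁ z₂‖ := norm_nonneg _
  nlinarith [hsq, h0]

omit h₂ hc1 hc2 in
/-- `sixtyPoint` is at spherical distance exactly `60°` from `z₁`: `⟪z₁, sixtyPoint z₁ z₂⟫ = 1/2`. -/
theorem inner_sixtyPoint : ⟪z₁, sixtyPoint z₁ z₂⟫ = 1 / 2 := by
  have h11 : ⟪z₁, z₁⟫ = 1 := by rw [real_inner_self_eq_norm_sq, h₁, one_pow]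
  rw [sixtyPoint, inner_add_right, real_inner_smul_right, real_inner_smul_right, h11]
  ring

omit h₁ h₂ in
/-- **Transfer of half-space bounds to the sixty-degree point.** For `0 ≤ t` with
`t ≤ ⟪N, z₁⟫` and `t ≤ ⟪N, z₂⟫` we get `t ≤ ⟪N, sixtyPoint z₁ z₂⟫` (both coefficients are `≥ 0`
and sum to `≥ 1`). Used with `t = √(1−M) ‖w i × w (i+1)‖`: edge lines far from `z₁` and `z₂`
are far from the sixty-degree point. -/
theorem le_inner_sixtyPoint {N : E3} {t : ℝ} (ht : 0 ≤ t) (ht₁ : t ≤ ⟪N, z₁⟫) (ht₂ : t ≤ ⟪N, z₂⟫) :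
    t ≤ ⟪N, sixtyPoint z₁ z₂⟫ := by
  obtain ⟨hα, hβ, hsum⟩ := sixtyPoint_coeffs hc1 hc2
  rw [sixtyPoint, inner_add_right, real_inner_smul_right, real_inner_smul_right]
  set α := 1 / 2 - ⟪z₁, z₂⟫ * (Real.sqrt 3 / 2 / Real.sqrt (1 - ⟪z₁, z₂⟫ ^ 2))
  set β := Real.sqrt 3 / 2 / Real.sqrt (1 - ⟪z₁, z₂⟫ ^ 2)
  calc t ≤ (α + β) * t := le_mul_of_one_le_left ht hsum
    _ = α * t + β * t := by ring
    _ ≤ α * ⟪N, z₁⟫ + β * ⟪N, z₂⟫ :=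
        add_le_add (mul_le_mul_of_nonneg_left ht₁ hα) (mul_le_mul_of_nonneg_left ht₂ hβ)

omit h₁ h₂ in
/-- The sixty-degree point lies in every closed half-space / cone containing `z₁` and `z₂`. -/
theorem inner_sixtyPoint_nonneg {N : E3} (h1 : 0 ≤ ⟪N, z₁⟫) (h2 : 0 ≤ ⟪N, z₂⟫) :
    0 ≤ ⟪N, sixtyPoint z₁ z₂⟫ :=
  le_inner_sixtyPoint hc1 hc2 le_rfl h1 h2

end Sixty



end Summit.Ventures.Crystal3D

end
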